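import Summits.BirchSwinnertonDyer.BirchSwinnertonDyer.Theorems.UniversalToricDescentSigmaCongruenceAtThreeIffInvariantPair
import HarnessLib

/-!
# NODE `heegner-log-anchor` (D-0171) for the crux A = `SigmaCongruenceAtThree` (stmt-BirchSwinnertonDyer-27120,
# route `UniversalToricDescent`, parent ♭T≤ `DefectTransportModThreePT` stmt-23042) — crux-ideate standing cover
# `cruxidea-stmt-BirchSwinnertonDyer-27120-1` GEN 2 (planner, 2026-08-30). Idea card: `Ideas/heegner-log-anchor.md`.

HONEST FRAMING. Nothing here proves A, ♭T≤, the route or any case of BSD. This file TYPES a two-piece split of A over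
EXISTING declarations and PROVES (kernel, no `sorry`, no new axiom, no banned option): the ANCHOR CASE of A outright
(§2), the composition `P1 → P2 → A` (§4) and both converses `A → P1`, `A → P2` (§4), so that `A ⟺ P1 ∧ P2` with
P1 print-attackable. Every `def` below is a `Prop` (nothing asserted).

## The lever (one sentence)
At analytic rank one the Σ-depleted frames `X := 𝓛·Π_E(3^c)` and `Y := 𝓛′·Π_{E′}(3^c)` of A have CONSTANT TERMS
`X(0) = 𝓛(𝟙)·∏_{v∈T} P_v(E)(q_v⁻¹)`, `Y(0) = 𝓛′(𝟙)·∏_{v∈T} P_v(E′)(q_v⁻¹)` (the binomial series `(1+T)^{e_v}` is `1`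
at `T = 0`, §3 `coeff_zero_mul_map_prod` — so the constant term is BLIND to the exponents `e_v`), i.e. by the `p`-adic
Waldspurger formulas at the trivial character (`𝓛(𝟙) ≐ (log_{ω_E} P_K / c_E)²`, no Euler factor at the supercuspidal
wild prime — tree `UniversalToricDescentWaldspurgerFlat.wildSplitWaldspurgerAtThree_flat_forall`, CONDITIONAL on the LZZ
additive fact; `𝓛′(𝟙) ≐ ((|Ẽ′^{ns}(𝔽₃)|/3)·log_{ω_{E′}} P′_K / c_{E′})²`, BDP13 Thm 5.13 / CGLS22 Thm 5.1.3 at `3 ∤ N′`, LZZ18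
Thm 1.5.3 at `3 ‖ N′`) they are, up to units of `R₀` and up to the COMMON factors at the `M`-primes, the SQUARES of the
two sides `X_E = (∏_{ℓ∣3NN′/M} |Ẽ^{ns}(𝔽_ℓ)|/ℓ)·log_{ω_E}P/c_E`, `X_{E′} = …` of Kriz–Li's Heegner-log congruence
`X_E ≡ ± X_{E′} (mod 3)` (Forum Math. Sigma 7 (2019) e15, Thm 1.16 — «we do not require E to have good reduction at
p», §1.6; tree fact A314 `KrizLi2019.thm116_padicLogHeegner_congruence`, consumed at `p = 3` across the additive/good
divide by the O5 node `Rank1Residual.O5.KrizLiUnitBitTransportThree`, PROVED from A314 in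
`O5/HeegnerLogTransportThreeKrizLiGlue.lean`, p352538). Hence THE UNIT BIT OF THE CONSTANT TERM TRANSPORTS from the twin
to the wild curve (piece P1). And on the ANCHOR LOCUS `‖Y(0)‖ = 1` that bit DECIDES A: a power series over the local
ring `R₀` with unit constant term is a UNIT of `R₀⟦T⟧`, so `X ≡ (X·Y⁻¹)·Y` is the Σ-congruence with `u := X·Y⁻¹` — A by
DIVISION (§2, kernel: `sigmaCongruenceAtThree_onAnchor`; it is `exists_isUnit_forall_norm_coeff_sub_lt_of_normProfile` at
profile `0`). What is left of A is the OFF-ANCHOR piece P2: A on the exceptional locus `‖Y(0)‖ < 1` (⟺ by Kriz–Li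
`‖X(0)‖ < 1` too: BOTH Σ-depleted λ-invariants are `≥ 1`), i.e. `3 ∣ X_{E′}` — a thin, INSTRUMENTABLE locus.

## Pieces and tags (D-0171; evidence in brackets)
* §2 `sigmaCongruenceAtThree_onAnchor` — A's binders `→ ‖X(0)‖ = 1 → ‖Y(0)‖ = 1 →` A's conclusion. **PROVED** here
  (kernel; `e_v := 3^{c_v}`, `pow_three_ne_zero_and_valuation`).
* P1 `AnchorTransportAtThree` — A's binders `→ ‖Y(0)‖ = 1 → ‖X(0)‖ = 1`. **WEAKER** than A [kernel:
  `anchorTransport_of_sigmaCongruenceAtThree : A → P1`, via §3 and `normProfile_of_forall_norm_sub_lt`]. Leaf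
  **ATTACKABLE** from print, size L, chain: (a) A314 Kriz–Li Thm 1.16 at `p = 3`, `m = 1` (tree; the O5 reading
  `KrizLiUnitBitTransportThree` is the `↔` of unit bits for `klExponent + padicLogOrd − ord₃ c`, any reduction type);
  (b) E-side value at 𝟙 `wildSplitWaldspurgerAtThree_flat_forall` (tree, mod `LiuZhangZhang2018.thm151_thm153_modularCurve_
  heegnerVector_additive`; R₀-frames ↦ ♭-frames as in `UniversalToricDescentSelfMuZero.self_forall_isBDPLFunction_coeff_norm_eq_one`;
  `BranchInducesPrime` = the `hι′` clause); (c) twin value at 𝟙 at `p = 3`: `3 ‖ N′` — LZZ18 Thm 1.5.3, tree fact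
  `LiuZhangZhang2018.thm151_thm153_modularCurve_heegnerVector` (typed at `p ‖ N` split); `3 ∤ N′` — BDP13 Thm 5.13 /
  CGLS22 Thm 5.1.3 (`p ∤ 2N′`, so `p = 3` IS in print) — NOT YET TYPED at `p = 3` (`Castella2018.thm32_exists_isBDPLFunction_
  valueAtOne` is `5 ≤ p`, squarefree `N`): THE one missing typed fact of this leaf; (d) bookkeeping `Π_E(3^c)(0) =
  ∏_{ℓ∣NN′, ℓ≠3} (|Ẽ^{ns}(𝔽_ℓ)|/ℓ)²` (§3 + `P_ℓ(1/ℓ) = |Ẽ^{ns}(𝔽_ℓ)|/ℓ`, two places of `K` over each split `ℓ`; at the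
  `M`-primes the two sides carry factors CONGRUENT mod 3, harmless for the unit bit; Kriz–Li's factor at `ℓ = 3` is `1`
  on the additive side and `|Ẽ′^{ns}(𝔽₃)|/3` on the twin side = exactly the BDP Euler factor of (c)); (e) Heegner points
  `P ∈ E(K)`, `P′ ∈ E′(K)` over `heegnerPointComplex` from `exists_map_eq_heegnerPointComplex`; non-torsion is NOT needed as
  a hypothesis (where `log P′ = 0` the anchor hypothesis fails). No multiplicity one, no Gorenstein, no period comparison,
  no Λ-adic form at level 27 enters — the inputs the other four ideas need.
* P2 `SigmaCongruenceAtThreeOffAnchor` — A's binders `→ ‖Y(0)‖ < 1 →` A's conclusion. **UNDECIDED** (formally WEAKER: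
  `offAnchor_of_sigmaCongruenceAtThree : A → P2`; in substance the research residue, EQUIV to A given P1 by §4). Leaves:
  **IDEA-NEEDED** — child = the registered line `Lines/sqrt_toric_functional.lean` (its `SigmaCongruenceAtThree_of` proves A,
  a fortiori P2; on P2's locus it may use the extra information `λ(X) ≥ 1 ∧ λ(Y) ≥ 1`); **INSTRUMENTABLE** — the ANCHOR
  CENSUS (kit 0 on this seat; spec in the idea card §Cheapest falsifier): for each of the 206 O6 classes `E` and its least
  Heegner field `K` with `3` split, `ord₃((∏_{ℓ∣N, ℓ≠3}|Ẽ^{ns}(𝔽_ℓ)|/ℓ)·log_{ω_E}P_K/c_E)` (readable on `E` ALONE by (a));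
  `= 0` ⟹ the pair is on the anchor locus and A HOLDS for it by §2 + P1; analogous instrument already run on the tame
  additive cell: O5 census C-KL3-V (Kriz–Li unit-bit predictions P-KL3-1/2, 870/870, `HOME/b2b-bsdres-o5-r2/gen16/kl3/`).
* No piece is COSTUME: P1 has a print proof-chain and is implied by A; P2 drops a locus on which A is now a theorem
  modulo P1. BARRIER leaves: none — `Literature/Barriers/BirchSwinnertonDyer/TraceZeroHeegnerTowerAtAdditiveSplitP` concerns
  norm-compatible Heegner families up the anticyclotomic tower at an additive split `p`; P1 uses the BOTTOM point `P_K` only.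

Disproof used: none exists for this crux (`ledger crux ls`, 2026-08-30: no `Disproof.lean`, no `Negative/`); negatives index
(2 entries, `EquivariantChebotarevAtTwo`, `LeadingTermTamePinch`) unrelated. Dead lines 24208 (kernel_rat RK-6 v2) / 24209 /
RK-7 v1 are not touched: no statement here mentions `X_{∅,0}`, characteristic ideals or the wall 20395.
-/

set_option autoImplicit false
-- `…BirchSwinnertonDyer.BirchSwinnertonDyer…` is the problem's mandated namespace (D-0017).
set_option linter.dupNamespace false

noncomputable section

open scoped Classical

namespace Summit.BirchSwinnertonDyer.BirchSwinnertonDyer.Cruxes.SigmaCongruenceAtThree.HeegnerLogAnchor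

open NumberField IsDedekindDomain
open Literature.NumberTheory.EllipticCurves Literature.NumberTheory.EllipticCurves.GreenbergVatsal2000
  Summit.BirchSwinnertonDyer.Rank1Residual.X11b
  Summit.BirchSwinnertonDyer.BirchSwinnertonDyer.Theorems.UniversalToricDescentNormProfile
  Summit.BirchSwinnertonDyer.BirchSwinnertonDyer.Theorems.UniversalToricDescentAcEulerFactor
  Summit.BirchSwinnertonDyer.BirchSwinnertonDyer.Theorems
  Summit.BirchSwinnertonDyer.BirchSwinnertonDyer.Theses.UniversalToricDescent

/-! ### §1 The two pieces (Props; binders = A's binders VERBATIM, exponents frozen at `e_v := 3^{c_v}`) -/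

/-- **P1 `AnchorTransportAtThree` [WEAKER than A · leaf ATTACKABLE from print].** Over A's binders: if the constant term
of the twin's Σ-depleted frame `𝓛′·Π_{E′}(3^c)` is a unit of `R₀`, so is the constant term of the wild curve's
`𝓛·Π_E(3^c)`. (= the square of Kriz–Li's congruence `X_E ≡ ±X_{E′} (mod 3)` read on unit bits, via the two `p`-adic
Waldspurger values at 𝟙; see the module docstring (a)–(e).) [cite: KrizLi2019, Thm. 1.16, Rem. 3.10, §1.6]
[cite: LiuZhangZhang2018, Thm 1.5.1 and Thm 1.5.3] [cite: BertoliniDarmonPrasanna2013, Thm. 5.13] -/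
def AnchorTransportAtThree : Prop :=
  ∀ (W : WeierstrassCurve ℚ) [W.IsElliptic] [W.IsGloballyMinimal] (W' : WeierstrassCurve ℚ) [W'.IsElliptic] [W'.IsGloballyMinimal] (N N' : ℕ) [NeZero N] [NeZero N'] (K : Type) [Field K] [NumberField K] (Dt : Literature.NumberTheory.EllipticCurves.ModularForms.ModularParametrizationData W N) (Dt' : Literature.NumberTheory.EllipticCurves.ModularForms.ModularParametrizationData W' N'), Summit.BirchSwinnertonDyer.Rank1Residual.Additive.ClassO6 W 3 → W.HasSurjectiveModNGaloisRep 3 → W.analyticRank = 1 → W.conductorNorm ℤ = N → Summit.BirchSwinnertonDyer.Rank1Residual.O6.ModPCongruent W' W 3 → ¬ Literature.NumberTheory.EllipticCurves.Rank1Residual.Addv W' 3 → W'.conductorNorm ℤ = N' → Literature.NumberTheory.EllipticCurves.IsImaginaryQuadratic K → Literature.NumberTheory.EllipticCurves.SatisfiesHeegnerHypothesis N K → Literature.NumberTheory.EllipticCurves.SatisfiesHeegnerHypothesis N' K → ∀ (κ : Literature.NumberTheory.EllipticCurves.ZpExtension K 3), κ.IsAnticyclotomic → ∀ (γ : Field.absoluteGaloisGroup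 K) [Fact (κ.IsTopGenerator γ)] (𝔭 : IsDedekindDomain.HeightOneSpectrum (NumberField.RingOfIntegers K)), ((3 : ℕ) : NumberField.RingOfIntegers K) ∈ 𝔭.asIdeal → 𝔭.asIdeal.ramificationIdx (NumberField.RingOfIntegers ℚ) = 1 → 𝔭.asIdeal.inertiaDeg (NumberField.RingOfIntegers ℚ) = 1 → ∀ (𝔭' : IsDedekindDomain.HeightOneSpectrum (NumberField.RingOfIntegers K)), ((3 : ℕ) : NumberField.RingOfIntegers K) ∈ 𝔭'.asIdeal → 𝔭' ≠ 𝔭 → ∀ (ι' : PadicAlgCl 3 ≃+* ℂ), Summit.BirchSwinnertonDyer.BirchSwinnertonDyer.Theorems.SchneiderFree.BranchInducesPrime 3 ι' 𝔭 → ∀ (ΩK : ℂ) (Ωp : ℂ_[3]) (L : Literature.NumberTheory.EllipticCurves.UnrSeries 3), ΩK ≠ 0 → Ωp ≠ 0 → Literature.NumberTheory.EllipticCurves.IsBDPLFunction ι' 𝔭 κ γ Dt.f ΩK Ωp L → ∀ (ΩK' : ℂ) (Ωp' : ℂ_[3]) (L' : Literature.NumberTheory.EllipticCurves.UnrSeries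 3), ΩK' ≠ 0 → Ωp' ≠ 0 → Literature.NumberTheory.EllipticCurves.IsBDPLFunction ι' 𝔭 κ γ Dt'.f ΩK' Ωp' L' → (∃ i : ℕ, ‖((PowerSeries.coeff i L' : Literature.NumberTheory.EllipticCurves.unrIntegers 3) : ℂ_[3])‖ = 1) → ∀ (T : Finset (IsDedekindDomain.HeightOneSpectrum (NumberField.RingOfIntegers K))) (c : IsDedekindDomain.HeightOneSpectrum (NumberField.RingOfIntegers K) → ℕ), (↑T = {v : IsDedekindDomain.HeightOneSpectrum (NumberField.RingOfIntegers K) | ((3 : ℕ) : NumberField.RingOfIntegers K) ∉ v.asIdeal ∧ (¬ (W.baseChange K).HasGoodReductionAt v ∨ ¬ (W'.baseChange K).HasGoodReductionAt v)}) → (∀ v ∈ T, (∃ d₀ : Literature.NumberTheory.EllipticCurves.GreenbergSelmer.decomp (K := K) v, (κ (d₀ : Field.absoluteGaloisGroup K)).toAdd = (3 : ℤ_[3]) ^ c v) ∧ (∀ d : Literature.NumberTheory.EllipticCurves.GreenbergSelmer.decomp (K := K) v, (3 : ℤ_[3]) ^ c v ∣ (κ (d : Field.absoluteGaloisGroup K)).toAdd))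 → ‖((PowerSeries.coeff 0 (L' * PowerSeries.map (Summit.BirchSwinnertonDyer.Rank1Residual.X11b.Halves.toUnr 3) (∏ v ∈ T, (Polynomial.aeval (PowerSeries.C ((Nat.card (IsLocalRing.ResidueField (v.adicCompletionIntegers K)) : ℤ_[3]).inv) * PowerSeries.binomialSeries ℤ_[3] ((3 : ℤ_[3]) ^ c v)) ((W'.baseChange K).localPolynomialAt v) : Literature.NumberTheory.EllipticCurves.IwasawaAlgebra 3))) : Literature.NumberTheory.EllipticCurves.unrIntegers 3) : ℂ_[3])‖ = 1 → ‖((PowerSeries.coeff 0 (L * PowerSeries.map (Summit.BirchSwinnertonDyer.Rank1Residual.X11b.Halves.toUnr 3) (∏ v ∈ T, (Polynomial.aeval (PowerSeries.C ((Nat.card (IsLocalRing.ResidueField (v.adicCompletionIntegers K)) : ℤ_[3]).inv) * PowerSeries.binomialSeries ℤ_[3] ((3 : ℤ_[3]) ^ c v)) ((W.baseChange K).localPolynomialAt v) : Literature.NumberTheory.EllipticCurves.IwasawaAlgebra 3))) : Literature.NumberTheory.EllipticCurves.unrIntegers 3) : ℂ_[3])‖ = 1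

/-- **P2 `SigmaCongruenceAtThreeOffAnchor` [UNDECIDED · the research residue · leaves IDEA-NEEDED + INSTRUMENTABLE].**
A VERBATIM, restricted to the exceptional (off-anchor) locus: the constant term of `𝓛′·Π_{E′}(3^c)` is a NON-unit of
`R₀` (⟺ `3 ∣ X_{E′}` ⟺ by Kriz–Li `3 ∣ X_E`: both Σ-depleted `λ`-invariants are `≥ 1`).
[cite: GreenbergVatsal2000, Thm. (1.5)] [cite: KrizLi2019, Thm. 1.16] -/
def SigmaCongruenceAtThreeOffAnchor : Prop :=
  ∀ (W : WeierstrassCurve ℚ) [W.IsElliptic] [W.IsGloballyMinimal] (W' : WeierstrassCurve ℚ) [W'.IsElliptic] [W'.IsGloballyMinimal] (N N' : ℕ) [NeZero N] [NeZero N'] (K : Type) [Field K] [NumberField K] (Dt : Literature.NumberTheory.EllipticCurves.ModularForms.ModularParametrizationData W N) (Dt' : Literature.NumberTheory.EllipticCurves.ModularForms.ModularParametrizationData W' N'), Summit.BirchSwinnertonDyer.Rank1Residual.Additive.ClassO6 W 3 → W.HasSurjectiveModNGaloisRep 3 → W.analyticRank = 1 → W.conductorNorm ℤ = N → Summit.BirchSwinnertonDyer.Rank1Residual.O6.ModPCongruent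 W' W 3 → ¬ Literature.NumberTheory.EllipticCurves.Rank1Residual.Addv W' 3 → W'.conductorNorm ℤ = N' → Literature.NumberTheory.EllipticCurves.IsImaginaryQuadratic K → Literature.NumberTheory.EllipticCurves.SatisfiesHeegnerHypothesis N K → Literature.NumberTheory.EllipticCurves.SatisfiesHeegnerHypothesis N' K → ∀ (κ : Literature.NumberTheory.EllipticCurves.ZpExtension K 3), κ.IsAnticyclotomic → ∀ (γ : Field.absoluteGaloisGroup K) [Fact (κ.IsTopGenerator γ)] (𝔭 : IsDedekindDomain.HeightOneSpectrum (NumberField.RingOfIntegers K)), ((3 : ℕ) : NumberField.RingOfIntegers K) ∈ 𝔭.asIdeal → 𝔭.asIdeal.ramificationIdx (NumberField.RingOfIntegers ℚ) = 1 → 𝔭.asIdeal.inertiaDeg (NumberField.RingOfIntegers ℚ) = 1 → ∀ (𝔭' : IsDedekindDomain.HeightOneSpectrum (NumberField.RingOfIntegers K)), ((3 : ℕ) : NumberField.RingOfIntegers K) ∈ 𝔭'.asIdeal → 𝔭' ≠ 𝔭 → ∀ (ι' : PadicAlgCl 3 ≃+* ℂ), Summit.BirchSwinnertonDyer.BirchSwinnertonDyer.Theorems.SchneiderFree.BranchInducesPrime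 3 ι' 𝔭 → ∀ (ΩK : ℂ) (Ωp : ℂ_[3]) (L : Literature.NumberTheory.EllipticCurves.UnrSeries 3), ΩK ≠ 0 → Ωp ≠ 0 → Literature.NumberTheory.EllipticCurves.IsBDPLFunction ι' 𝔭 κ γ Dt.f ΩK Ωp L → ∀ (ΩK' : ℂ) (Ωp' : ℂ_[3]) (L' : Literature.NumberTheory.EllipticCurves.UnrSeries 3), ΩK' ≠ 0 → Ωp' ≠ 0 → Literature.NumberTheory.EllipticCurves.IsBDPLFunction ι' 𝔭 κ γ Dt'.f ΩK' Ωp' L' → (∃ i : ℕ, ‖((PowerSeries.coeff i L' : Literature.NumberTheory.EllipticCurves.unrIntegers 3) : ℂ_[3])‖ = 1) → ∀ (T : Finset (IsDedekindDomain.HeightOneSpectrum (NumberField.RingOfIntegers K))) (c : IsDedekindDomain.HeightOneSpectrum (NumberField.RingOfIntegers K) → ℕ), (↑T = {v : IsDedekindDomain.HeightOneSpectrum (NumberField.RingOfIntegers K) | ((3 : ℕ) : NumberField.RingOfIntegers K) ∉ v.asIdeal ∧ (¬ (W.baseChange K).HasGoodReductionAt v ∨ ¬ (W'.baseChange K).HasGoodReductionAt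 v)}) → (∀ v ∈ T, (∃ d₀ : Literature.NumberTheory.EllipticCurves.GreenbergSelmer.decomp (K := K) v, (κ (d₀ : Field.absoluteGaloisGroup K)).toAdd = (3 : ℤ_[3]) ^ c v) ∧ (∀ d : Literature.NumberTheory.EllipticCurves.GreenbergSelmer.decomp (K := K) v, (3 : ℤ_[3]) ^ c v ∣ (κ (d : Field.absoluteGaloisGroup K)).toAdd)) → ‖((PowerSeries.coeff 0 (L' * PowerSeries.map (Summit.BirchSwinnertonDyer.Rank1Residual.X11b.Halves.toUnr 3) (∏ v ∈ T, (Polynomial.aeval (PowerSeries.C ((Nat.card (IsLocalRing.ResidueField (v.adicCompletionIntegers K)) : ℤ_[3]).inv) * PowerSeries.binomialSeries ℤ_[3] ((3 : ℤ_[3]) ^ c v)) ((W'.baseChange K).localPolynomialAt v) : Literature.NumberTheory.EllipticCurves.IwasawaAlgebra 3))) : Literature.NumberTheory.EllipticCurves.unrIntegers 3) : ℂ_[3])‖ < 1 → ∃ (e : IsDedekindDomain.HeightOneSpectrum (NumberField.RingOfIntegers K) → ℤ_[3]) (u : Literature.NumberTheory.EllipticCurves.UnrSeries 3), IsUnit u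 ∧ (∀ v ∈ T, e v ≠ 0 ∧ (e v).valuation = c v) ∧ ∀ i : ℕ, ‖((PowerSeries.coeff i (L * PowerSeries.map (Summit.BirchSwinnertonDyer.Rank1Residual.X11b.Halves.toUnr 3) (∏ v ∈ T, (Polynomial.aeval (PowerSeries.C ((Nat.card (IsLocalRing.ResidueField (v.adicCompletionIntegers K)) : ℤ_[3]).inv) * PowerSeries.binomialSeries ℤ_[3] (e v)) ((W.baseChange K).localPolynomialAt v) : Literature.NumberTheory.EllipticCurves.IwasawaAlgebra 3)) - u * (L' * PowerSeries.map (Summit.BirchSwinnertonDyer.Rank1Residual.X11b.Halves.toUnr 3) (∏ v ∈ T, (Polynomial.aeval (PowerSeries.C ((Nat.card (IsLocalRing.ResidueField (v.adicCompletionIntegers K)) : ℤ_[3]).inv) * PowerSeries.binomialSeries ℤ_[3] (e v)) ((W'.baseChange K).localPolynomialAt v) : Literature.NumberTheory.EllipticCurves.IwasawaAlgebra 3)))) : Literature.NumberTheory.EllipticCurves.unrIntegers 3) : ℂ_[3])‖ < 1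

/-! ### §2 The anchor case of A is a THEOREM (division by a unit of `R₀⟦T⟧`) -/

/-- **A on the anchor locus, PROVED.** Over A's binders: if BOTH constant terms `(𝓛·Π_E(3^c))(0)` and
`(𝓛′·Π_{E′}(3^c))(0)` are units of `R₀`, A's conclusion holds with `e_v := 3^{c_v}` and `u := X·Y⁻¹` — both series have
norm profile `0`, and equal profiles are congruent `mod 𝔪_{R₀}` up to a unit
(`exists_isUnit_forall_norm_coeff_sub_lt_of_normProfile`). [cite: Washington1997, §7.1] -/
theorem sigmaCongruenceAtThree_onAnchor :
    ∀ (W : WeierstrassCurve ℚ) [W.IsElliptic] [W.IsGloballyMinimal] (W' : WeierstrassCurve ℚ) [W'.IsElliptic] [W'.IsGloballyMinimal] (N N' : ℕ) [NeZero N] [NeZero N'] (K : Type) [Field K] [NumberField K] (Dt : Literature.NumberTheory.EllipticCurves.ModularForms.ModularParametrizationData W N) (Dt' : Literature.NumberTheory.EllipticCurves.ModularForms.ModularParametrizationData W' N'), Summit.BirchSwinnertonDyer.Rank1Residual.Additive.ClassO6 W 3 → W.HasSurjectiveModNGaloisRep 3 → W.analyticRank = 1 → W.conductorNorm ℤ =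 N → Summit.BirchSwinnertonDyer.Rank1Residual.O6.ModPCongruent W' W 3 → ¬ Literature.NumberTheory.EllipticCurves.Rank1Residual.Addv W' 3 → W'.conductorNorm ℤ = N' → Literature.NumberTheory.EllipticCurves.IsImaginaryQuadratic K → Literature.NumberTheory.EllipticCurves.SatisfiesHeegnerHypothesis N K → Literature.NumberTheory.EllipticCurves.SatisfiesHeegnerHypothesis N' K → ∀ (κ : Literature.NumberTheory.EllipticCurves.ZpExtension K 3), κ.IsAnticyclotomic → ∀ (γ : Field.absoluteGaloisGroup K) [Fact (κ.IsTopGenerator γ)] (𝔭 : IsDedekindDomain.HeightOneSpectrum (NumberField.RingOfIntegers K)), ((3 : ℕ) : NumberField.RingOfIntegers K) ∈ 𝔭.asIdeal → 𝔭.asIdeal.ramificationIdx (NumberField.RingOfIntegers ℚ) = 1 → 𝔭.asIdeal.inertiaDeg (NumberField.RingOfIntegers ℚ) = 1 → ∀ (𝔭' : IsDedekindDomain.HeightOneSpectrum (NumberField.RingOfIntegers K)), ((3 : ℕ) : NumberField.RingOfIntegers K) ∈ 𝔭'.asIdeal → 𝔭' ≠ 𝔭 → ∀ (ι' : PadicAlgCl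 3 ≃+* ℂ), Summit.BirchSwinnertonDyer.BirchSwinnertonDyer.Theorems.SchneiderFree.BranchInducesPrime 3 ι' 𝔭 → ∀ (ΩK : ℂ) (Ωp : ℂ_[3]) (L : Literature.NumberTheory.EllipticCurves.UnrSeries 3), ΩK ≠ 0 → Ωp ≠ 0 → Literature.NumberTheory.EllipticCurves.IsBDPLFunction ι' 𝔭 κ γ Dt.f ΩK Ωp L → ∀ (ΩK' : ℂ) (Ωp' : ℂ_[3]) (L' : Literature.NumberTheory.EllipticCurves.UnrSeries 3), ΩK' ≠ 0 → Ωp' ≠ 0 → Literature.NumberTheory.EllipticCurves.IsBDPLFunction ι' 𝔭 κ γ Dt'.f ΩK' Ωp' L' → (∃ i : ℕ, ‖((PowerSeries.coeff i L' : Literature.NumberTheory.EllipticCurves.unrIntegers 3) : ℂ_[3])‖ = 1) → ∀ (T : Finset (IsDedekindDomain.HeightOneSpectrum (NumberField.RingOfIntegers K))) (c : IsDedekindDomain.HeightOneSpectrum (NumberField.RingOfIntegers K) → ℕ), (↑T = {v : IsDedekindDomain.HeightOneSpectrum (NumberField.RingOfIntegers K) | ((3 : ℕ) : NumberField.RingOfIntegers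 K) ∉ v.asIdeal ∧ (¬ (W.baseChange K).HasGoodReductionAt v ∨ ¬ (W'.baseChange K).HasGoodReductionAt v)}) → (∀ v ∈ T, (∃ d₀ : Literature.NumberTheory.EllipticCurves.GreenbergSelmer.decomp (K := K) v, (κ (d₀ : Field.absoluteGaloisGroup K)).toAdd = (3 : ℤ_[3]) ^ c v) ∧ (∀ d : Literature.NumberTheory.EllipticCurves.GreenbergSelmer.decomp (K := K) v, (3 : ℤ_[3]) ^ c v ∣ (κ (d : Field.absoluteGaloisGroup K)).toAdd)) → ‖((PowerSeries.coeff 0 (L * PowerSeries.map (Summit.BirchSwinnertonDyer.Rank1Residual.X11b.Halves.toUnr 3) (∏ v ∈ T, (Polynomial.aeval (PowerSeries.C ((Nat.card (IsLocalRing.ResidueField (v.adicCompletionIntegers K)) : ℤ_[3]).inv) * PowerSeries.binomialSeries ℤ_[3] ((3 : ℤ_[3]) ^ c v)) ((W.baseChange K).localPolynomialAt v) : Literature.NumberTheory.EllipticCurves.IwasawaAlgebra 3))) : Literature.NumberTheory.EllipticCurves.unrIntegers 3) : ℂ_[3])‖ = 1 → ‖((PowerSeries.coeff 0 (L' * PowerSeries.map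 (Summit.BirchSwinnertonDyer.Rank1Residual.X11b.Halves.toUnr 3) (∏ v ∈ T, (Polynomial.aeval (PowerSeries.C ((Nat.card (IsLocalRing.ResidueField (v.adicCompletionIntegers K)) : ℤ_[3]).inv) * PowerSeries.binomialSeries ℤ_[3] ((3 : ℤ_[3]) ^ c v)) ((W'.baseChange K).localPolynomialAt v) : Literature.NumberTheory.EllipticCurves.IwasawaAlgebra 3))) : Literature.NumberTheory.EllipticCurves.unrIntegers 3) : ℂ_[3])‖ = 1 → ∃ (e : IsDedekindDomain.HeightOneSpectrum (NumberField.RingOfIntegers K) → ℤ_[3]) (u : Literature.NumberTheory.EllipticCurves.UnrSeries 3), IsUnit u ∧ (∀ v ∈ T, e v ≠ 0 ∧ (e v).valuation = c v) ∧ ∀ i : ℕ, ‖((PowerSeries.coeff i (L * PowerSeries.map (Summit.BirchSwinnertonDyer.Rank1Residual.X11b.Halves.toUnr 3) (∏ v ∈ T, (Polynomial.aeval (PowerSeries.C ((Nat.card (IsLocalRing.ResidueField (v.adicCompletionIntegers K)) : ℤ_[3]).inv) * PowerSeries.binomialSeries ℤ_[3] (e v)) ((W.baseChange K).localPolynomialAt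 v) : Literature.NumberTheory.EllipticCurves.IwasawaAlgebra 3)) - u * (L' * PowerSeries.map (Summit.BirchSwinnertonDyer.Rank1Residual.X11b.Halves.toUnr 3) (∏ v ∈ T, (Polynomial.aeval (PowerSeries.C ((Nat.card (IsLocalRing.ResidueField (v.adicCompletionIntegers K)) : ℤ_[3]).inv) * PowerSeries.binomialSeries ℤ_[3] (e v)) ((W'.baseChange K).localPolynomialAt v) : Literature.NumberTheory.EllipticCurves.IwasawaAlgebra 3)))) : Literature.NumberTheory.EllipticCurves.unrIntegers 3) : ℂ_[3])‖ < 1 := by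
  intro W _ _ W' _ _ N N' _ _ K _ _ Dt Dt' hO6 hsurj hrk hN hmod haddv hN' hK hH hH' κ hκ γ _ 𝔭 h𝔭 hram hdeg 𝔭' h𝔭' hne ι' hι ΩK Ωp L hΩK hΩp hL ΩK' Ωp' L' hΩK' hΩp' hL' hi' T c hT hc hX hY
  obtain ⟨u, hu, hcong⟩ := exists_isUnit_forall_norm_coeff_sub_lt_of_normProfile (n := 0)
    ⟨fun i hi ↦ absurd hi (Nat.not_lt_zero i), hX⟩ ⟨fun i hi ↦ absurd hi (Nat.not_lt_zero i), hY⟩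
  exact ⟨fun v ↦ (3 : ℤ_[3]) ^ c v, u, hu,
    fun v _ ↦ UniversalToricDescentSigmaCongruenceInvariantPair.pow_three_ne_zero_and_valuation (c v), hcong⟩

/-! ### §3 The constant term of a Σ-depleted frame is blind to the exponents `e_v` -/

/-- `[T⁰] P(C a · (1+T)^e) = P(a)` for `P ∈ ℤ[X]`: the binomial series has constant term `1`. [folklore] -/
theorem constantCoeff_aeval_C_mul_binomialSeries (a e : ℤ_[3]) (P : Polynomial ℤ) :
    PowerSeries.constantCoeff
        (Polynomial.aeval (PowerSeries.C a * PowerSeries.binomialSeries ℤ_[3] e) P : IwasawaAlgebra 3) =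
      Polynomial.aeval a P := by
  rw [Polynomial.aeval_def, Polynomial.hom_eval₂, map_mul, PowerSeries.constantCoeff_C,
    PowerSeries.binomialSeries_constantCoeff, mul_one, Polynomial.aeval_def]
  congr 1

/-- `[T⁰]` commutes with the coefficient map `ℤ₃⟦T⟧ → R₀⟦T⟧`. [folklore] -/
theorem constantCoeff_map_toUnr (φ : IwasawaAlgebra 3) :
    PowerSeries.constantCoeff (PowerSeries.map (Halves.toUnr 3) φ) =
      Halves.toUnr 3 (PowerSeries.constantCoeff φ) := by
  rw [← PowerSeries.coeff_zero_eq_constantCoeff_apply, PowerSeries.coeff_map,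
    PowerSeries.coeff_zero_eq_constantCoeff_apply]

/-- **`[T⁰](𝓛 · ∏_{v∈T} P_v(q_v (1+T)^{e_v})) = 𝓛(0) · ∏_{v∈T} P_v(q_v)` in `R₀`** — independent of the exponents
`e_v`. [folklore] -/
theorem coeff_zero_mul_map_prod {ι : Type*} (L : UnrSeries 3) (T : Finset ι) (q e : ι → ℤ_[3])
    (P : ι → Polynomial ℤ) :
    PowerSeries.coeff 0 (L * PowerSeries.map (Halves.toUnr 3)
        (∏ v ∈ T, (Polynomial.aeval (PowerSeries.C (q v) * PowerSeries.binomialSeries ℤ_[3] (e v)) (P v) :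
          IwasawaAlgebra 3))) =
      PowerSeries.constantCoeff L * Halves.toUnr 3 (∏ v ∈ T, Polynomial.aeval (q v) (P v)) := by
  rw [PowerSeries.coeff_zero_eq_constantCoeff_apply, map_mul, constantCoeff_map_toUnr, map_prod]
  congr 2
  exact Finset.prod_congr rfl fun v _ ↦ constantCoeff_aeval_C_mul_binomialSeries (q v) (e v) (P v)

/-! ### §4 Composition and converses: `A ⟺ P1 ∧ P2` -/

/-- **`P1 → P2 → A`** (concludes the crux BY NAME): split on the unit bit of `(𝓛′·Π_{E′}(3^c))(0)`; on the anchor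
locus P1 supplies the other unit bit and §2 applies; off it, P2 is A. -/
theorem sigmaCongruenceAtThree_of_anchor_of_offAnchor (h₁ : AnchorTransportAtThree)
    (h₂ : SigmaCongruenceAtThreeOffAnchor) : SigmaCongruenceAtThree := by
  intro W _ _ W' _ _ N N' _ _ K _ _ Dt Dt' hO6 hsurj hrk hN hmod haddv hN' hK hH hH' κ hκ γ _ 𝔭 h𝔭 hram hdeg 𝔭' h𝔭' hne ι' hι ΩK Ωp L hΩK hΩp hL ΩK' Ωp' L' hΩK' hΩp' hL' hi' T c hT hc
  by_cases hY : ‖((PowerSeries.coeff 0 (L' * PowerSeries.map (Summit.BirchSwinnertonDyer.Rank1Residual.X11b.Halves.toUnr 3) (∏ v ∈ T, (Polynomial.aeval (PowerSeries.C ((Nat.card (IsLocalRing.ResidueField (v.adicCompletionIntegers K)) : ℤ_[3]).inv) * PowerSeries.binomialSeries ℤ_[3] ((3 : ℤ_[3]) ^ c v)) ((W'.baseChange K).localPolynomialAt v) : Literature.NumberTheory.EllipticCurves.IwasawaAlgebra 3))) : unrIntegers 3) : ℂ_[3])‖ = 1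
  · exact sigmaCongruenceAtThree_onAnchor W W' N N' K Dt Dt' hO6 hsurj hrk hN hmod haddv hN' hK hH hH' κ hκ γ 𝔭 h𝔭 hram hdeg 𝔭' h𝔭' hne ι' hι ΩK Ωp L hΩK hΩp hL ΩK' Ωp' L' hΩK' hΩp' hL' hi' T c hT hc (h₁ W W' N N' K Dt Dt' hO6 hsurj hrk hN hmod haddv hN' hK hH hH' κ hκ γ 𝔭 h𝔭 hram hdeg 𝔭' h𝔭' hne ι' hι ΩK Ωp L hΩK hΩp hL ΩK' Ωp' L' hΩK' hΩp' hL' hi' T c hT hc hY) hY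
  · exact h₂ W W' N N' K Dt Dt' hO6 hsurj hrk hN hmod haddv hN' hK hH hH' κ hκ γ 𝔭 h𝔭 hram hdeg 𝔭' h𝔭' hne ι' hι ΩK Ωp L hΩK hΩp hL ΩK' Ωp' L' hΩK' hΩp' hL' hi' T c hT hc (lt_of_le_of_ne (Halves.norm_coe_unrIntegers_le_one 3 _) hY)

/-- **`A → P1`**: a Σ-congruence `X ≡ u·Y (mod 𝔪)` with `u` a unit preserves norm profiles, and the constant terms do
not see the exponents `e_v` (§3), so `‖Y(0)‖ = 1 ⇒ ‖X(0)‖ = 1` for the frozen exponents `3^{c_v}` as well. -/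
theorem anchorTransport_of_sigmaCongruenceAtThree (hA : SigmaCongruenceAtThree) : AnchorTransportAtThree := by
  intro W _ _ W' _ _ N N' _ _ K _ _ Dt Dt' hO6 hsurj hrk hN hmod haddv hN' hK hH hH' κ hκ γ _ 𝔭 h𝔭 hram hdeg 𝔭' h𝔭' hne ι' hι ΩK Ωp L hΩK hΩp hL ΩK' Ωp' L' hΩK' hΩp' hL' hi' T c hT hc hY
  obtain ⟨e, u, hu, -, hcong⟩ := hA W W' N N' K Dt Dt' hO6 hsurj hrk hN hmod haddv hN' hK hH hH' κ hκ γ 𝔭 h𝔭 hram hdeg 𝔭' h𝔭' hne ι' hι ΩK Ωp L hΩK hΩp hL ΩK' Ωp' L' hΩK' hΩp' hL' hi' T c hT hc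
  rw [coeff_zero_mul_map_prod L' T (fun v : HeightOneSpectrum (𝓞 K) ↦ ((Nat.card (IsLocalRing.ResidueField (v.adicCompletionIntegers K)) : ℤ_[3]).inv)) (fun v : HeightOneSpectrum (𝓞 K) ↦ (3 : ℤ_[3]) ^ c v) (fun v ↦ (W'.baseChange K).localPolynomialAt v)] at hY
  have hYe : (∀ i < 0, ‖((PowerSeries.coeff i (L' * PowerSeries.map (Halves.toUnr 3)
      (∏ v ∈ T, (Polynomial.aeval (PowerSeries.C ((Nat.card (IsLocalRing.ResidueField
        (v.adicCompletionIntegers K)) : ℤ_[3]).inv) * PowerSeries.binomialSeries ℤ_[3] (e v))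
        ((W'.baseChange K).localPolynomialAt v) : IwasawaAlgebra 3))) : unrIntegers 3) : ℂ_[3])‖ < 1) ∧
      ‖((PowerSeries.coeff 0 (L' * PowerSeries.map (Halves.toUnr 3)
      (∏ v ∈ T, (Polynomial.aeval (PowerSeries.C ((Nat.card (IsLocalRing.ResidueField
        (v.adicCompletionIntegers K)) : ℤ_[3]).inv) * PowerSeries.binomialSeries ℤ_[3] (e v))
        ((W'.baseChange K).localPolynomialAt v) : IwasawaAlgebra 3))) : unrIntegers 3) : ℂ_[3])‖ = 1 := by
    refine ⟨fun i hi ↦ absurd hi (Nat.not_lt_zero i), ?_⟩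
    rw [coeff_zero_mul_map_prod L' T (fun v : HeightOneSpectrum (𝓞 K) ↦ ((Nat.card (IsLocalRing.ResidueField (v.adicCompletionIntegers K)) : ℤ_[3]).inv)) e (fun v ↦ (W'.baseChange K).localPolynomialAt v)]
    exact hY
  have hX := (normProfile_of_forall_norm_sub_lt hcong (normProfile_mul_of_isUnit hu hYe)).2
  rw [coeff_zero_mul_map_prod L T (fun v : HeightOneSpectrum (𝓞 K) ↦ ((Nat.card (IsLocalRing.ResidueField (v.adicCompletionIntegers K)) : ℤ_[3]).inv)) e (fun v ↦ (W.baseChange K).localPolynomialAt v)] at hX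
  rw [coeff_zero_mul_map_prod L T (fun v : HeightOneSpectrum (𝓞 K) ↦ ((Nat.card (IsLocalRing.ResidueField (v.adicCompletionIntegers K)) : ℤ_[3]).inv)) (fun v : HeightOneSpectrum (𝓞 K) ↦ (3 : ℤ_[3]) ^ c v) (fun v ↦ (W.baseChange K).localPolynomialAt v)]
  exact hX

/-- **`A → P2`** (drop the locus hypothesis). -/
theorem offAnchor_of_sigmaCongruenceAtThree (hA : SigmaCongruenceAtThree) : SigmaCongruenceAtThreeOffAnchor := by
  intro W _ _ W' _ _ N N' _ _ K _ _ Dt Dt' hO6 hsurj hrk hN hmod haddv hN' hK hH hH' κ hκ γ _ 𝔭 h𝔭 hram hdeg 𝔭' h𝔭' hne ι' hι ΩK Ωp L hΩK hΩp hL ΩK' Ωp' L' hΩK' hΩp' hL' hi' T c hT hc _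
  exact hA W W' N N' K Dt Dt' hO6 hsurj hrk hN hmod haddv hN' hK hH hH' κ hκ γ 𝔭 h𝔭 hram hdeg 𝔭' h𝔭' hne ι' hι ΩK Ωp L hΩK hΩp hL ΩK' Ωp' L' hΩK' hΩp' hL' hi' T c hT hc

/-- **The node's certificate: `A ⟺ P1 ∧ P2`.** -/
theorem sigmaCongruenceAtThree_iff_anchor_and_offAnchor :
    SigmaCongruenceAtThree ↔ AnchorTransportAtThree ∧ SigmaCongruenceAtThreeOffAnchor :=
  ⟨fun hA ↦ ⟨anchorTransport_of_sigmaCongruenceAtThree hA, offAnchor_of_sigmaCongruenceAtThree hA⟩,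
    fun h ↦ sigmaCongruenceAtThree_of_anchor_of_offAnchor h.1 h.2⟩

end Summit.BirchSwinnertonDyer.BirchSwinnertonDyer.Cruxes.SigmaCongruenceAtThree.HeegnerLogAnchor

end
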